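import Literature.MathematicalPhysics.QuantumLattice.HubbardNNNHoppingBootstrapCertificate
import Literature.MathematicalPhysics.QuantumLattice.HubbardFreeKineticLowerBound
import Literature.MathematicalPhysics.QuantumLattice.HubbardTTPrimeHoppingSupergradient
import HarnessLib

/-!
# The hopping-RANGE residual priced by the Fermi sea of the dropped graph:
# `E_N(H) + E_N(T″) ≤ E_N(H + T″) ≤ E_N(H) − E_N(−T″)`

Family `hubbard` (topic `MathematicalPhysics/QuantumLattice`; finite volume, any graph). Written for
stage S1/S2 of the Hubbard material-oracle programme, seat `hubbard-downfold-unc-3` («robustness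
lemmas consumed by S2: … Lipschitz constant from certified hopping-correlator bounds»), answering the
cell's INFL-TRUNC question (`router/BOX-SCHEMA.md` §8: a material's one-band block carries object M =
the Wannier Hamiltonian truncated at printed range `t, t′, t″, t‴, …` and object E = the `t–t′`-only
refit; stage S2 certifies the `t–t′` family, so every word about M needs the model-form residual of the
dropped hopping graphs). The generic residual in the tree
(`Summit.Ventures.CertifiedManyBodySolver.Downfold.abs_groundEnergy_add_hopping_sub_le`) is Weyl's
inequality in a sector with the OPERATOR NORM, `|E_N(H + T″) − E_N(H)| ≤ ‖T″‖ ≤ 2|t″|Δ″|Λ|`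
(`8|t″|` per site for straight second neighbours, which it calls «nearly void»). Here the residual is
priced STATE-DEPENDENTLY — by the sector ground energies of the dropped hopping term itself, i.e. by
its free FERMI SEA at the same particle number:

* §1 `groundEnergy_add_le_sub_groundEnergy_neg`, `groundEnergy_add_mem_Icc` — for Hermitian,
  particle-number conserving `A`, `B` on a finite lattice and `N ≤ 2|Λ|`,
  `E_N(A) + E_N(B) ≤ E_N(A + B) ≤ E_N(A) − E_N(−B)` (the tree's superadditivity
  `ThermodynamicLimit.groundEnergy_add_ge`, read twice).
* §2 (`hamiltonian G (−t) 0 = −hamiltonian G t 0`, private) the RESIDUAL BRACKET for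
  a dropped/added hopping graph `G″` with amplitude `t″`:
  `E_N(hamiltonian G″ t″ 0) ≤ E_N(H + hamiltonian G″ t″ 0) − E_N(H) ≤ −E_N(hamiltonian G″ (−t″) 0)`
  (`groundEnergy_add_hopping_sub_mem_Icc`), and its CERTIFIED form through Lieb–Loss' free Fermi-sea
  bound `FreeKinetic.groundEnergyAt_ge` (`μN + 2Σ_i min(λ_i(∓t″A_{G″}) − μ, 0) ≤ E_N(hamiltonian G″ (±t″) 0)`
  for every `μ`): `groundEnergy_add_hopping_sub_ge_fermiSea`, `groundEnergy_add_hopping_sub_le_fermiSea`,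
  floor/cap transport `groundEnergy_add_hopping_ge_of_le_fermiSea`, `groundEnergy_add_hopping_le_of_le_fermiSea`.
  On a bipartite `G″` the two prices coincide; on the square torus with straight second neighbours the
  free Fermi sea of `2t″(cos 2k_x + cos 2k_y)` at half filling is `−(16/π²)|t″|` per site in the
  thermodynamic limit (`≈ 1.62|t″|` against `8|t″|`), and `−4|t″|n` per site at low density.

Everything is PROVED; no definition, no named fact, no number. HONEST SCOPE: energy words only
(dimensionless / order words have no generic transport across a model-form residual); finite volume;
the thermodynamic-limit statement for a three-graph torus family would need that family's
Hamiltonian, which the tree does not define.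

## Mathlib / tree search

REUSED: `ThermodynamicLimit.groundEnergy_add_ge` (superadditivity of the sector ground energy,
`HubbardNNNHoppingBootstrapCertificate`), `FreeKinetic.groundEnergyAt_ge` (`HubbardFreeKineticLowerBound`),
`LiebThm1.hamiltonian_isHermitian`, `LiebThm1.preservesSectors_hamiltonian`,
`TTPrimeFree.hamiltonian_zero_eq_neg_smul_hopOp`, `groundEnergyAt` (= `groundEnergy (hamiltonian G t U)`).
`lean search 'groundEnergy_add_le_sub|fermiSea|add_hopping_sub_mem_Icc' --decl`: nothing; the operator-norm
residual is `Summits/Ventures/CertifiedManyBodySolver/Downfold/HoppingTruncationBound.lean` (not importable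
from `Literature/`, and not restated).

## References

* P. W. Anderson, Phys. Rev. 83 (1951) 1260, eq. (2) (superadditivity / cluster lower bound).
  [cite: Anderson1951, eq. (2)]
* E. H. Lieb, M. Loss, Duke Math. J. 71 (1993) 337, §8 Thm. 8.2 (sum of the lowest one-body levels
  bounds the kinetic energy of `N` fermions). [cite: LiebLoss1993, §8, Theorem 8.2]
-/

noncomputable section

namespace Literature.MathematicalPhysics.QuantumLattice

open Matrix Finset HubbardWave0 ThermodynamicLimit
open scoped ComplexOrder BigOperators

variable {Λ : Type*} [LinearOrder Λ] [Fintype Λ]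

/-! ### §1 Two-sided Weyl bracket in a sector, priced by the perturbation's own sector energies -/

/-- **Upper Weyl bound in a sector, state-dependent price**: for Hermitian particle-number conserving
`A`, `B` and `N ≤ 2|Λ|`, `E_N(A + B) ≤ E_N(A) − E_N(−B)` (superadditivity applied to
`(A + B) + (−B) = A`). [cite: Anderson1951, eq. (2)] -/
theorem groundEnergy_add_le_sub_groundEnergy_neg (A B : Matrix (Finset (Orb Λ)) (Finset (Orb Λ)) ℂ)
    (hA : A.IsHermitian) (hB : B.IsHermitian) (hpA : PreservesSectors A) (hpB : PreservesSectors B)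
    {N : ℕ} (hN : N ≤ 2 * Fintype.card Λ) :
    groundEnergy (A + B) N ≤ groundEnergy A N - groundEnergy (-B) N := by
  have h := groundEnergy_add_ge (A + B) (-B) (hA.add hB) hB.neg (hpA.add hpB) hpB.neg hN
  rw [add_neg_cancel_right] at h
  linarith

/-- **Two-sided Weyl bracket in a sector**: `E_N(A) + E_N(B) ≤ E_N(A + B) ≤ E_N(A) − E_N(−B)` — the
shift of every sector ground energy by a Hermitian particle-conserving perturbation `B` lies between
the lowest and minus-the-lowest sector energies of `B` and `−B` (never wider than `[−‖B‖, ‖B‖]`).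
[cite: Anderson1951, eq. (2)] -/
theorem groundEnergy_add_mem_Icc (A B : Matrix (Finset (Orb Λ)) (Finset (Orb Λ)) ℂ)
    (hA : A.IsHermitian) (hB : B.IsHermitian) (hpA : PreservesSectors A) (hpB : PreservesSectors B)
    {N : ℕ} (hN : N ≤ 2 * Fintype.card Λ) :
    groundEnergy (A + B) N ∈
      Set.Icc (groundEnergy A N + groundEnergy B N) (groundEnergy A N - groundEnergy (-B) N) :=
  ⟨groundEnergy_add_ge A B hA hB hpA hpB hN, groundEnergy_add_le_sub_groundEnergy_neg A B hA hB hpA hpB hN⟩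

/-! ### §2 Dropping or adding a hopping graph: the residual is the free Fermi sea of that graph -/

section Hopping

variable (G : SimpleGraph Λ) [DecidableRel G.Adj]

/-- `hamiltonian G (−t) 0 = −hamiltonian G t 0` (the pure hopping term is linear in `t`). [folklore] -/
private theorem hamiltonian_neg_zero (t : ℝ) : hamiltonian G (-t) 0 = -hamiltonian G t 0 := by
  rw [TTPrimeFree.hamiltonian_zero_eq_neg_smul_hopOp, TTPrimeFree.hamiltonian_zero_eq_neg_smul_hopOp,
    Complex.ofReal_neg, neg_neg, neg_smul, neg_neg]

/-- **The hopping-range residual bracket**: for Hermitian particle-conserving `H`, a hopping graph `G″`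
with amplitude `t″` and `N ≤ 2|Λ|`,
`E_N(hamiltonian G″ t″ 0) ≤ E_N(H + hamiltonian G″ t″ 0) − E_N(H) ≤ −E_N(hamiltonian G″ (−t″) 0)`:
the shift is bracketed by the free `N`-fermion ground energies of the dropped term and of its
negative. [cite: Anderson1951, eq. (2)] -/
theorem groundEnergy_add_hopping_sub_mem_Icc {H : Matrix (Finset (Orb Λ)) (Finset (Orb Λ)) ℂ}
    (hH : H.IsHermitian) (hHp : PreservesSectors H) (t'' : ℝ) {N : ℕ} (hN : N ≤ 2 * Fintype.card Λ) :
    groundEnergy (H + hamiltonian G t'' 0) N - groundEnergy H N ∈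
      Set.Icc (groundEnergy (hamiltonian G t'' 0) N) (-groundEnergy (hamiltonian G (-t'') 0) N) := by
  have h := groundEnergy_add_mem_Icc H (hamiltonian G t'' 0) hH (LiebThm1.hamiltonian_isHermitian G t'' 0)
    hHp (LiebThm1.preservesSectors_hamiltonian G t'' 0) hN
  rw [← hamiltonian_neg_zero] at h
  constructor <;> linarith [h.1, h.2]

/-- **Certified LOWER residual (Fermi-sea price)**: for every chemical potential `μ`,
`μN + 2Σ_i min(λ_i(−t″A_{G″}) − μ, 0) ≤ E_N(H + hamiltonian G″ t″ 0) − E_N(H)` — Lieb–Loss' free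
kinetic bound for the dropped graph (`FreeKinetic.groundEnergyAt_ge`). [cite: LiebLoss1993, §8, Theorem 8.2] -/
theorem groundEnergy_add_hopping_sub_ge_fermiSea {H : Matrix (Finset (Orb Λ)) (Finset (Orb Λ)) ℂ}
    (hH : H.IsHermitian) (hHp : PreservesSectors H) (t'' μ : ℝ) {N : ℕ} (hN : N ≤ 2 * Fintype.card Λ) :
    μ * N + 2 * ∑ i, min ((LangerMattis.isHermitian_hopMatrix G (-t'')).eigenvalues i - μ) 0 ≤
      groundEnergy (H + hamiltonian G t'' 0) N - groundEnergy H N :=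
  (FreeKinetic.groundEnergyAt_ge G t'' le_rfl μ hN).trans
    (groundEnergy_add_hopping_sub_mem_Icc G hH hHp t'' hN).1

/-- **Certified UPPER residual (Fermi-sea price of the negative graph)**: for every `μ`,
`E_N(H + hamiltonian G″ t″ 0) − E_N(H) ≤ −(μN + 2Σ_i min(λ_i(t″A_{G″}) − μ, 0))`.
[cite: LiebLoss1993, §8, Theorem 8.2] -/
theorem groundEnergy_add_hopping_sub_le_fermiSea {H : Matrix (Finset (Orb Λ)) (Finset (Orb Λ)) ℂ}
    (hH : H.IsHermitian) (hHp : PreservesSectors H) (t'' μ : ℝ) {N : ℕ} (hN : N ≤ 2 * Fintype.card Λ) :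
    groundEnergy (H + hamiltonian G t'' 0) N - groundEnergy H N ≤
      -(μ * N + 2 * ∑ i, min ((LangerMattis.isHermitian_hopMatrix G t'').eigenvalues i - μ) 0) := by
  have h1 := (groundEnergy_add_hopping_sub_mem_Icc G hH hHp t'' hN).2
  have h2 := FreeKinetic.groundEnergyAt_ge G (-t'') le_rfl μ hN
  unfold groundEnergyAt at h2
  rw [neg_neg] at h2
  linarith

/-- **Floor transport across the residual, Fermi-sea price**: a certified floor `L ≤ E_N(H)` for the
truncated object gives `L + μN + 2Σ_i min(λ_i(−t″A_{G″}) − μ, 0) ≤ E_N(H + hamiltonian G″ t″ 0)` for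
every `μ`. [cite: LiebLoss1993, §8, Theorem 8.2] -/
theorem groundEnergy_add_hopping_ge_of_le_fermiSea {H : Matrix (Finset (Orb Λ)) (Finset (Orb Λ)) ℂ}
    (hH : H.IsHermitian) (hHp : PreservesSectors H) (t'' μ : ℝ) {N : ℕ} (hN : N ≤ 2 * Fintype.card Λ)
    {L : ℝ} (hL : L ≤ groundEnergy H N) :
    L + (μ * N + 2 * ∑ i, min ((LangerMattis.isHermitian_hopMatrix G (-t'')).eigenvalues i - μ) 0) ≤
      groundEnergy (H + hamiltonian G t'' 0) N := by
  have h := groundEnergy_add_hopping_sub_ge_fermiSea G hH hHp t'' μ hN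
  linarith

/-- **Cap transport across the residual, Fermi-sea price**: `E_N(H) ≤ R` gives
`E_N(H + hamiltonian G″ t″ 0) ≤ R − (μN + 2Σ_i min(λ_i(t″A_{G″}) − μ, 0))` for every `μ`.
[cite: LiebLoss1993, §8, Theorem 8.2] -/
theorem groundEnergy_add_hopping_le_of_le_fermiSea {H : Matrix (Finset (Orb Λ)) (Finset (Orb Λ)) ℂ}
    (hH : H.IsHermitian) (hHp : PreservesSectors H) (t'' μ : ℝ) {N : ℕ} (hN : N ≤ 2 * Fintype.card Λ)
    {R : ℝ} (hR : groundEnergy H N ≤ R) :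
    groundEnergy (H + hamiltonian G t'' 0) N ≤
      R - (μ * N + 2 * ∑ i, min ((LangerMattis.isHermitian_hopMatrix G t'').eigenvalues i - μ) 0) := by
  have h := groundEnergy_add_hopping_sub_le_fermiSea G hH hHp t'' μ hN
  linarith

/-- **Dropping a graph** (the direction object M ↦ object E): `E_N(H) − E_N(H + T″)` is bracketed
the other way round, `E_N(hamiltonian G″ (−t″) 0) ≤ E_N(H) − E_N(H + hamiltonian G″ t″ 0) ≤ −E_N(hamiltonian G″ t″ 0)`
(apply the bracket to `H + T″` and the graph `−t″`). [cite: Anderson1951, eq. (2)] -/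
theorem groundEnergy_sub_add_hopping_mem_Icc {H : Matrix (Finset (Orb Λ)) (Finset (Orb Λ)) ℂ}
    (hH : H.IsHermitian) (hHp : PreservesSectors H) (t'' : ℝ) {N : ℕ} (hN : N ≤ 2 * Fintype.card Λ) :
    groundEnergy H N - groundEnergy (H + hamiltonian G t'' 0) N ∈
      Set.Icc (groundEnergy (hamiltonian G (-t'') 0) N) (-groundEnergy (hamiltonian G t'' 0) N) := by
  have h := groundEnergy_add_hopping_sub_mem_Icc G hH hHp t'' hN
  constructor <;> linarith [h.1, h.2]

end Hopping

end Literature.MathematicalPhysics.QuantumLattice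

end
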